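import Mathlib
import HarnessLib
import Summits.Ventures.LatticeQCDFlow.Scaling.AutoregressiveGaugeHeatBathVolumeFloor
import Summits.Ventures.LatticeQCDFlow.Scaling.BoxPeelingClosingBound
import Summits.Ventures.LatticeQCDFlow.Scaling.BoxClosingSection
import Summits.Ventures.LatticeQCDFlow.Scaling.BoxHeatBathSampler

/-!
# LatticeQCDFlow / Scaling — FREE BOUNDARY DOES NOT SAVE THE SAMPLER: the exact heat-bath autoregression of
# a box of `(ℤ/L)³` has acceptance `≤ (M₂/M)^s` at the cold configuration and an event with
# `τ_int ≥ 1/(π(A) + (M₂/M)^s/θ) − 1/2`, `(R−1)³ ≤ 3s`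

HONEST FRAMING: exact (Metropolis-corrected) sampling algorithms for lattice gauge theory;
figures of merit are autocorrelation/cost numbers at stated couplings and volumes; no
continuum-physics claim.

Venture `LatticeQCDFlow` (cell pub-lqcd), topic `Scaling`, FANOUT row 30 (lean-1, GEN-26) — OUR WORK on
THEORY-2.md §4 row C5, the free-boundary companion of `Scaling/AutoregressiveGaugeHeatBathVolumeFloor` /
`…VolumeLaw`.  GEN-25 (`BoxHeatBathSampler`): for the free-boundary weight `F_K = ∏_{p∈K} w(U_p)` of a box
`K` of `(ℤ/L)^d` and the exact heat-bath autoregression on the largest ranked structure inside it, the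
Metropolis step accepts with probability `≥ (m/M)^{#(K∖B)}` (`(m/M)^{(R−1)³}` in `d = 3`, `1` in `d = 2`) and
`τ_int ≤ (M/m)^{#(K∖B)} − 1/2`.  Here is the matching floor, from `BoxPeelingClosingBound`
(`Z_K/Z_B ≤ M^{k−s} M₂^{s}`) and `BoxClosingSection` (`(R−1)³ ≤ 3s` in the three-dimensional box):

* **`closing_blockVolumeFloor`** — for `B ⊆ K` ranked with a closing section of size `s` inside `K`: the
  acceptance mass of the exact sampler from every `U` is `≤ (M₂/M)^s · M^{#(K∖B)}/F_{K∖B}(U)`, and every event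
  `A ⊆ {F_{K∖B} > θ M^{#(K∖B)}}` of positive target probability has
  `τ_int(1_A − π(A)) ≥ 1/(π(A) + (M₂/M)^s/θ) − 1/2`;
* **`exists_boxOptimal_volumeFloor_three`** — the box of side `R` of `(ℤ/L)³` (`1 ≤ R`, `R + 1 ≤ L`): an
  optimal structure (`(R−1)³` box plaquettes outside) with `(R−1)³ ≤ 3s` to which the above applies:
  ONE FACTOR `M₂/M` PER THREE UNIT CUBES — the free-boundary sampler is exponentially slow in the box volume
  too (`d = 2`: `s = 0`, no obstruction, consistent with free-boundary exactness).

No `def`, no `sorry`, nothing cited as a fact.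
-/

noncomputable section

namespace Summit.Ventures.LatticeQCDFlow.Theory2.Autoregressive

open MeasureTheory ProbabilityTheory Function Finset
open Summit.Ventures.LatticeQCDFlow.Exactness Summit.Ventures.LatticeQCDFlow.Scoring
open Literature.MathematicalPhysics.QuantumFieldTheory Literature.MathematicalPhysics.QuantumLattice
open scoped ENNReal

variable {d L : ℕ} [NeZero L] {G : Type*} [Group G] [TopologicalSpace G] [IsTopologicalGroup G]
  [CompactSpace G] [SecondCountableTopology G] [MeasurableSpace G] [BorelSpace G]

/-- **THE FLOOR OF THE FREE-BOUNDARY (BLOCK-TARGET) HEAT-BATH SAMPLER WITH A CLOSING SECTION.**  `L ≥ 2`;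
`w` continuous, `0 < m ≤ w ≤ M`; two-plaquette constant `M₂`; `B ⊆ K` ranked with a closing section
`(S, u)` inside `K` (`S ⊆ K ∖ B`), `k = #(K ∖ B)`, `s = #S`; `π = (F_K/Z_K)·Haar^{⊗E}` the block target,
`q = (F_B/Z_B)·Haar^{⊗E}` the sub-block proposal, `indepMH q (Z_B F_{K∖B}/Z_K)` the exact sampler of
`BoxHeatBathSampler`.  Then (a) the acceptance mass from every `U` is `≤ (M₂/M)^s · M^k/F_{K∖B}(U)`;
(b) every event `A ⊆ {F_{K∖B} > θ M^k}` (`θ > 0`) of positive target probability has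
`τ_int(1_A − π(A)) ≥ 1/(π(A) + (M₂/M)^s/θ) − 1/2`. [ours] -/
theorem closing_blockVolumeFloor (hL : 2 ≤ L) {w : G → ℝ} (hw : Continuous w) {m M : ℝ} (hm0 : 0 < m)
    (hm : ∀ g, m ≤ w g) (hM : ∀ g, w g ≤ M) {M₂ : ℝ}
    (hM₂ : ∀ a b : G, ∫ h, w h * w (a * h * b) ∂(haarProbability G) ≤
      (∫ g, w g ∂(haarProbability G)) * M₂)
    (hM₂' : ∀ a b : G, ∫ h, w h * w (a * h⁻¹ * b) ∂(haarProbability G) ≤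
      (∫ g, w g ∂(haarProbability G)) * M₂)
    (B : Finset (Plaquette d L)) (t : Plaquette d L → Edge d L)
    (ht : ∀ p ∈ B, t p ∈ ({(p.1, p.2.1.1), (p.1.shift p.2.1.1, p.2.1.2),
        (p.1.shift p.2.1.2, p.2.1.1), (p.1, p.2.1.2)} : Finset (Edge d L)))
    (rank : Plaquette d L → ℕ)
    (hrank : ∀ p ∈ B, ∀ p' ∈ B, p ≠ p' → t p ∈ ({(p'.1, p'.2.1.1), (p'.1.shift p'.2.1.1, p'.2.1.2),
        (p'.1.shift p'.2.1.2, p'.2.1.1), (p'.1, p'.2.1.2)} : Finset (Edge d L)) → rank p < rank p')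
    (K : Finset (Plaquette d L)) (hBK : B ⊆ K)
    (S : Finset (Plaquette d L)) (u : Plaquette d L → Plaquette d L) (hSK : ∀ p' ∈ S, p' ∈ K)
    (hSB : ∀ p' ∈ S, p' ∉ B) (huB : ∀ p' ∈ S, u p' ∈ B)
    (hut : ∀ p' ∈ S, t (u p') ∈ ({(p'.1, p'.2.1.1), (p'.1.shift p'.2.1.1, p'.2.1.2),
        (p'.1.shift p'.2.1.2, p'.2.1.1), (p'.1, p'.2.1.2)} : Finset (Edge d L)))
    (humax : ∀ p' ∈ S, ∀ p ∈ B, p ≠ u p' → t p ∈ ({(p'.1, p'.2.1.1), (p'.1.shift p'.2.1.1, p'.2.1.2),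
        (p'.1.shift p'.2.1.2, p'.2.1.1), (p'.1, p'.2.1.2)} : Finset (Edge d L)) → rank p < rank (u p'))
    (huinj : Set.InjOn u S)
    (π q : Measure (GaugeConfig d L G)) [IsProbabilityMeasure π] [IsProbabilityMeasure q]
    (hπ : π = (Measure.pi fun _ : Edge d L => haarProbability G).withDensity fun U =>
      ENNReal.ofReal ((∏ p ∈ K, w (plaquetteHolonomy U p.1 p.2.1.1 p.2.1.2)) /
        ∫ V, ∏ p ∈ K, w (plaquetteHolonomy V p.1 p.2.1.1 p.2.1.2)
          ∂(Measure.pi fun _ : Edge d L => haarProbability G)))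
    (hq : q = (Measure.pi fun _ : Edge d L => haarProbability G).withDensity fun U =>
      ENNReal.ofReal ((∏ p ∈ B, w (plaquetteHolonomy U p.1 p.2.1.1 p.2.1.2)) /
        ∫ V, ∏ p ∈ B, w (plaquetteHolonomy V p.1 p.2.1.1 p.2.1.2)
          ∂(Measure.pi fun _ : Edge d L => haarProbability G))) :
    (∀ U : GaugeConfig d L G,
      (imhAcceptMass q (fun U =>
        ((∫ V, ∏ p ∈ K, w (plaquetteHolonomy V p.1 p.2.1.1 p.2.1.2)
            ∂(Measure.pi fun _ : Edge d L => haarProbability G)) /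
          ((∫ V, ∏ p ∈ B, w (plaquetteHolonomy V p.1 p.2.1.1 p.2.1.2)
            ∂(Measure.pi fun _ : Edge d L => haarProbability G)) *
            ∏ p ∈ K \ B, w (plaquetteHolonomy U p.1 p.2.1.1 p.2.1.2)))⁻¹) U).toReal ≤
        (M₂ / M) ^ S.card * (M ^ (K \ B).card /
          ∏ p ∈ K \ B, w (plaquetteHolonomy U p.1 p.2.1.1 p.2.1.2))) ∧
    ∀ θ : ℝ, 0 < θ → ∀ A : Set (GaugeConfig d L G), MeasurableSet A →
      (∀ U ∈ A, θ * M ^ (K \ B).card <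
        ∏ p ∈ K \ B, w (plaquetteHolonomy U p.1 p.2.1.1 p.2.1.2)) → 0 < π.real A →
      1 / (π.real A + (M₂ / M) ^ S.card / θ) - 1 / 2 ≤
        tauInt (fun n => autocov (indepMH q fun U =>
          ((∫ V, ∏ p ∈ K, w (plaquetteHolonomy V p.1 p.2.1.1 p.2.1.2)
              ∂(Measure.pi fun _ : Edge d L => haarProbability G)) /
            ((∫ V, ∏ p ∈ B, w (plaquetteHolonomy V p.1 p.2.1.1 p.2.1.2)
              ∂(Measure.pi fun _ : Edge d L => haarProbability G)) *
              ∏ p ∈ K \ B, w (plaquetteHolonomy U p.1 p.2.1.1 p.2.1.2)))⁻¹) π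
            (fun U => A.indicator (fun _ => (1 : ℝ)) U - π.real A) n /
          autocov (indepMH q fun U =>
          ((∫ V, ∏ p ∈ K, w (plaquetteHolonomy V p.1 p.2.1.1 p.2.1.2)
              ∂(Measure.pi fun _ : Edge d L => haarProbability G)) /
            ((∫ V, ∏ p ∈ B, w (plaquetteHolonomy V p.1 p.2.1.1 p.2.1.2)
              ∂(Measure.pi fun _ : Edge d L => haarProbability G)) *
              ∏ p ∈ K \ B, w (plaquetteHolonomy U p.1 p.2.1.1 p.2.1.2)))⁻¹) π
            (fun U => A.indicator (fun _ => (1 : ℝ)) U - π.real A) 0) := by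
  set Haar : Measure (GaugeConfig d L G) := Measure.pi fun _ : Edge d L => haarProbability G with hHaar
  set FT : GaugeConfig d L G → ℝ := fun U => ∏ p ∈ K, w (plaquetteHolonomy U p.1 p.2.1.1 p.2.1.2)
    with hFT
  set FB : GaugeConfig d L G → ℝ := fun U => ∏ p ∈ B, w (plaquetteHolonomy U p.1 p.2.1.1 p.2.1.2) with hFB
  set FR : GaugeConfig d L G → ℝ := fun U => ∏ p ∈ K \ B, w (plaquetteHolonomy U p.1 p.2.1.1 p.2.1.2)
    with hFR
  set ZT : ℝ := ∫ V, FT V ∂Haar with hZT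
  set ZB : ℝ := ∫ V, FB V ∂Haar with hZB
  set k : ℕ := (K \ B).card with hk
  set s : ℕ := S.card with hs
  have hw0 : ∀ g, 0 < w g := fun g => hm0.trans_le (hm g)
  have hMpos : 0 < M := (hw0 1).trans_le (hM 1)
  haveI : IsProbabilityMeasure Haar := by rw [hHaar]; infer_instance
  have hc : 0 < ∫ g, w g ∂(haarProbability G) := haarProbability_integral_pos_of_continuous_pos hw hw0
  have hFTc : Continuous FT := continuous_prodPlaquetteWeight_anyDim hw K
  have hFRc : Continuous FR := continuous_prodPlaquetteWeight_anyDim hw (K \ B)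
  have hFTpos : ∀ U, 0 < FT U := fun U => prod_pos fun p _ => hw0 _
  have hFRpos : ∀ U, 0 < FR U := fun U => prod_pos fun p _ => hw0 _
  have hFRle : ∀ U, FR U ≤ M ^ k := fun U => (pow_le_prodPlaquetteWeight_le_pow_anyDim hm0 hm hM _ U).2
  have hFTi : Integrable FT Haar := by
    refine Integrable.mono' (integrable_const (M ^ K.card))
      hFTc.aestronglyMeasurable (ae_of_all _ fun U => ?_)
    rw [Real.norm_eq_abs, abs_of_pos (hFTpos U)]
    exact (pow_le_prodPlaquetteWeight_le_pow_anyDim hm0 hm hM _ U).2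
  have hZTpos : 0 < ZT := by
    have h := integral_mono (integrable_const (m ^ K.card)) hFTi
      fun U => (pow_le_prodPlaquetteWeight_le_pow_anyDim hm0 hm hM _ U).1
    rw [integral_const, smul_eq_mul, probReal_univ, one_mul] at h
    exact lt_of_lt_of_le (pow_pos hm0 _) h
  have hZB : ZB = (∫ g, w g ∂(haarProbability G)) ^ B.card :=
    integral_prod_weight_eq_pow_of_rank (G := G) hL hw hm0 hm hM B t ht rank hrank
  have hZBpos : 0 < ZB := by rw [hZB]; exact pow_pos hc _
  -- the closing-section bound `Z/Z_B ≤ M^{k−s} M₂^s = (M₂/M)^s M^k`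
  have hSsub : S ⊆ K \ B := fun p' hp' => Finset.mem_sdiff.2 ⟨hSK p' hp', hSB p' hp'⟩
  have hsk : s ≤ k := Finset.card_le_card hSsub
  have hdiv : ZT / ZB ≤ M ^ (k - s) * M₂ ^ s :=
    integral_prod_weight_box_div_le_of_closing (G := G) hL hw hm0 hm hM hM₂ hM₂' B t ht rank hrank K hBK S u
      hSK hSB huB hut humax huinj
  have hM₂0 : 0 ≤ M₂ := by
    have h1 := hM₂ 1 1
    have h0 : 0 ≤ ∫ h, w h * w (1 * h * 1) ∂(haarProbability G) :=
      integral_nonneg fun h => mul_nonneg (hw0 _).le (hw0 _).le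
    exact (mul_nonneg_iff_of_pos_left hc).1 (h0.trans h1)
  have hpow : M ^ (k - s) * M₂ ^ s = (M₂ / M) ^ s * M ^ k := by
    have h1 : M ^ k = M ^ (k - s) * M ^ s := by rw [← pow_add, Nat.sub_add_cancel hsk]
    have hMs : M ^ s ≠ 0 := pow_ne_zero _ hMpos.ne'
    rw [h1, div_pow]
    field_simp
  -- the density ratio `ρ = Z/(Z_B F_R)` and the kernel weight `ρ⁻¹`
  set ρ : GaugeConfig d L G → ℝ := fun U => ZT / (ZB * FR U) with hρ
  have hρpos : ∀ U, 0 < ρ U := fun U => div_pos hZTpos (mul_pos hZBpos (hFRpos U))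
  have hρm : Measurable ρ := (continuous_const.div (continuous_const.mul hFRc)
    fun U => (mul_pos hZBpos (hFRpos U)).ne').measurable
  have hρle : ∀ U, ρ U ≤ (M₂ / M) ^ s * (M ^ k / FR U) := by
    intro U
    calc ρ U = (ZT / ZB) / FR U := by rw [hρ, div_div]
      _ ≤ (M ^ (k - s) * M₂ ^ s) / FR U := div_le_div_of_nonneg_right hdiv (hFRpos U).le
      _ = (M₂ / M) ^ s * (M ^ k / FR U) := by rw [hpow, mul_div_assoc]
  have hsplit : ∀ U, FT U = FR U * FB U := fun U => (Finset.prod_sdiff hBK).symm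
  have hFBpos : ∀ U, 0 < FB U := fun U => prod_pos fun p _ => hw0 _
  have hρq : q = π.withDensity fun U => ENNReal.ofReal (ρ U) := by
    rw [hq, hπ]
    change Haar.withDensity (fun U => ENNReal.ofReal (FB U / ZB)) =
      (Haar.withDensity fun U => ENNReal.ofReal (FT U / ZT)).withDensity fun U => ENNReal.ofReal (ρ U)
    rw [← withDensity_mul _ (by fun_prop : Measurable fun U => ENNReal.ofReal (FT U / ZT))
      (by exact hρm.ennreal_ofReal)]
    refine withDensity_congr_ae (ae_of_all _ fun U => ?_)
    simp only [Pi.mul_apply]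
    rw [← ENNReal.ofReal_mul (div_nonneg (hFTpos U).le hZTpos.le)]
    congr 1
    rw [hρ, hsplit U]
    field_simp [(hFRpos U).ne', hZBpos.ne', hZTpos.ne']
  have hπ' : (q.withDensity fun U => ENNReal.ofReal (ρ U)⁻¹) = π := withDensity_inv_density hρm hρpos hρq
  have hwm : Measurable fun U => (ρ U)⁻¹ := hρm.inv
  have hw0' : ∀ U, 0 < (ρ U)⁻¹ := fun U => inv_pos.2 (hρpos U)
  have hwb : ∀ U, |(ρ U)⁻¹| ≤ ZB * M ^ k / ZT := by
    intro U
    rw [abs_of_pos (hw0' U), hρ, inv_div]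
    exact div_le_div_of_nonneg_right (mul_le_mul_of_nonneg_left (hFRle U) hZBpos.le) hZTpos.le
  have hwi : Integrable (fun U => (ρ U)⁻¹) q := integrable_of_bounded q hwm hwb
  -- (a) the acceptance mass from `U` is at most `ρ(U)`
  have hone : ∫⁻ y, ENNReal.ofReal (ρ y)⁻¹ ∂q = 1 := by
    have h : π Set.univ = 1 := measure_univ
    rw [← hπ', withDensity_apply _ MeasurableSet.univ, Measure.restrict_univ] at h
    exact h
  have hacc : ∀ U, (imhAcceptMass q (fun U => (ρ U)⁻¹) U).toReal ≤ ρ U := by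
    intro U
    have h := imhAcceptMass_le (q := q) hw0' U
    rw [hone, mul_one, inv_inv] at h
    have h2 := ENNReal.toReal_mono ENNReal.ofReal_ne_top h
    rwa [ENNReal.toReal_ofReal (hρpos U).le] at h2
  refine ⟨fun U => (hacc U).trans (hρle U), ?_⟩
  -- (b) the `τ_int` floor of a frozen event
  intro θ hθ A hA hAθ hApos
  have hMM : 0 ≤ (M₂ / M) ^ s := pow_nonneg (div_nonneg hM₂0 hMpos.le) _
  have hηA : ∀ U ∈ A, (imhAcceptMass q (fun U => (ρ U)⁻¹) U).toReal ≤ (M₂ / M) ^ s / θ := by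
    intro U hU
    have h' : θ * M ^ k < FR U := hAθ U hU
    have hfr : M ^ k / FR U ≤ 1 / θ := by
      rw [div_le_div_iff₀ (hFRpos U) hθ, one_mul]; linarith
    refine (hacc U).trans ((hρle U).trans ?_)
    calc (M₂ / M) ^ s * (M ^ k / FR U) ≤ (M₂ / M) ^ s * (1 / θ) := mul_le_mul_of_nonneg_left hfr hMM
      _ = (M₂ / M) ^ s / θ := mul_one_div _ _
  set g : GaugeConfig d L G → ℝ := fun U => A.indicator (fun _ => (1 : ℝ)) U - π.real A with hg
  have hp1 : π.real A ≤ 1 := measureReal_le_one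
  have hgm : Measurable g := (measurable_const.indicator hA).sub measurable_const
  have hgb : ∀ U, |g U| ≤ 1 := by
    intro U
    by_cases hU : U ∈ A
    · simp only [hg, Set.indicator_of_mem hU]
      rw [abs_le]; constructor <;> linarith [hApos.le, hp1]
    · simp only [hg, Set.indicator_of_notMem hU]
      rw [abs_le]; constructor <;> linarith [hApos.le, hp1]
  have hg0 : ∫ U, g U ∂π = 0 := by
    simp only [hg]
    rw [integral_sub ((integrable_const _).indicator hA) (integrable_const _),
      integral_indicator_const (1 : ℝ) hA, integral_const, smul_eq_mul, smul_eq_mul, mul_one,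
      probReal_univ, one_mul, sub_self]
  have hcov := (subBlockProposal_autocorrelation (G := G) hw hm0 hm hM hBK π q hπ hq hgm hgb hg0).1
  -- summability of the autocorrelation series (Doeblin envelope of the scorecard)
  have hsum : Summable fun n => autocov (indepMH q fun U => (ρ U)⁻¹) π g (n + 1) /
      autocov (indepMH q fun U => (ρ U)⁻¹) π g 0 := by
    by_cases hz : autocov (indepMH q fun U => (ρ U)⁻¹) π g 0 = 0
    · simp only [hz, div_zero]; exact summable_zero
    · have hC0 : 0 < autocov (indepMH q fun U => (ρ U)⁻¹) π g 0 := by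
        rw [autocov_zero] at hz ⊢
        exact lt_of_le_of_ne (integral_nonneg fun U => sq_nonneg _) (Ne.symm hz)
      have hr0 : 0 ≤ 1 - (m / M) ^ k := by
        have : (m / M) ^ k ≤ 1 := pow_le_one₀ (div_nonneg hm0.le hMpos.le)
          ((div_le_one hMpos).2 (by linarith [hm 1, hM 1]))
        linarith
      have hr1 : 1 - (m / M) ^ k < 1 := by
        have : 0 < (m / M) ^ k := pow_pos (div_pos hm0 hMpos) _
        linarith
      refine Summable.of_norm_bounded ((summable_geometric_of_lt_one hr0 hr1).mul_left (1 - (m / M) ^ k))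
        fun n => ?_
      rw [Real.norm_eq_abs, abs_div, abs_of_pos hC0, div_le_iff₀ hC0]
      have h := hcov (n + 1)
      rw [← autocov_zero] at h
      calc |autocov (indepMH q fun U => (ρ U)⁻¹) π g (n + 1)|
          ≤ (1 - (m / M) ^ k) ^ (n + 1) * autocov (indepMH q fun U => (ρ U)⁻¹) π g 0 := h
        _ = (1 - (m / M) ^ k) * (1 - (m / M) ^ k) ^ n *
              autocov (indepMH q fun U => (ρ U)⁻¹) π g 0 := by ring
  exact indepMH_event_tauInt_ge hwm hw0' hwi hπ' hA (div_nonneg hMM hθ.le) hηA hApos hsum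


/-- **THE BOX OF `(ℤ/L)³`: FREE BOUNDARY DOES NOT SAVE THE SAMPLER.**  `1 ≤ R`, `R + 1 ≤ L`, `K` the
plaquettes of the box of side `R`; `w` continuous, `0 < m ≤ w ≤ M`, two-plaquette constant `M₂`.  There is
an OPTIMAL ranked structure `B ⊆ K` (exactly `(R−1)³` box plaquettes outside, one per unit cube) and an `s`
with `(R−1)³ ≤ 3s` such that for the box target `π = (F_K/Z_K)·Haar^{⊗E}`, the proposal
`q = (F_B/Z_B)·Haar^{⊗E}` and the exact sampler: the acceptance mass from `U` is
`≤ (M₂/M)^s · M^{(R−1)³}/F_{K∖B}(U)`, and every event `A ⊆ {F_{K∖B} > θ M^{(R−1)³}}` of positive target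
probability has `τ_int(1_A − π(A)) ≥ 1/(π(A) + (M₂/M)^s/θ) − 1/2`. [ours] -/
theorem exists_boxOptimal_volumeFloor_three {R : ℕ} (hR : 1 ≤ R) (hRL : R + 1 ≤ L) (hL : 2 ≤ L)
    (K : Finset (Plaquette 3 L))
    (hK : K = Finset.univ.filter (fun p : Plaquette 3 L =>
      (∀ m : Fin 3, (p.1 m).val < R) ∧ (p.1 p.2.1.1).val + 1 < R ∧ (p.1 p.2.1.2).val + 1 < R))
    {w : G → ℝ} (hw : Continuous w) {m M : ℝ} (hm0 : 0 < m) (hm : ∀ g, m ≤ w g) (hM : ∀ g, w g ≤ M)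
    {M₂ : ℝ}
    (hM₂ : ∀ a b : G, ∫ h, w h * w (a * h * b) ∂(haarProbability G) ≤
      (∫ g, w g ∂(haarProbability G)) * M₂)
    (hM₂' : ∀ a b : G, ∫ h, w h * w (a * h⁻¹ * b) ∂(haarProbability G) ≤
      (∫ g, w g ∂(haarProbability G)) * M₂) :
    ∃ (B : Finset (Plaquette 3 L)) (t : Plaquette 3 L → Edge 3 L) (rank : Plaquette 3 L → ℕ) (s : ℕ),
      B ⊆ K ∧
      (∀ p ∈ B, t p ∈ ({(p.1, p.2.1.1), (p.1.shift p.2.1.1, p.2.1.2),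
        (p.1.shift p.2.1.2, p.2.1.1), (p.1, p.2.1.2)} : Finset (Edge 3 L))) ∧
      (∀ p ∈ B, ∀ p' ∈ B, p ≠ p' → t p ∈ ({(p'.1, p'.2.1.1), (p'.1.shift p'.2.1.1, p'.2.1.2),
        (p'.1.shift p'.2.1.2, p'.2.1.1), (p'.1, p'.2.1.2)} : Finset (Edge 3 L)) → rank p < rank p') ∧
      (K \ B).card = (R - 1) ^ 3 ∧ (R - 1) ^ 3 ≤ 3 * s ∧
      ∀ (π q : Measure (GaugeConfig 3 L G)) [IsProbabilityMeasure π] [IsProbabilityMeasure q],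
        π = ((Measure.pi fun _ : Edge 3 L => haarProbability G).withDensity fun U =>
          ENNReal.ofReal ((∏ p ∈ K, w (plaquetteHolonomy U p.1 p.2.1.1 p.2.1.2)) /
            ∫ V, ∏ p ∈ K, w (plaquetteHolonomy V p.1 p.2.1.1 p.2.1.2)
              ∂(Measure.pi fun _ : Edge 3 L => haarProbability G))) →
        q = ((Measure.pi fun _ : Edge 3 L => haarProbability G).withDensity fun U =>
          ENNReal.ofReal ((∏ p ∈ B, w (plaquetteHolonomy U p.1 p.2.1.1 p.2.1.2)) /
            ∫ V, ∏ p ∈ B, w (plaquetteHolonomy V p.1 p.2.1.1 p.2.1.2)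
              ∂(Measure.pi fun _ : Edge 3 L => haarProbability G))) →
        (∀ U : GaugeConfig 3 L G,
          (imhAcceptMass q (fun U =>
            ((∫ V, ∏ p ∈ K, w (plaquetteHolonomy V p.1 p.2.1.1 p.2.1.2)
                ∂(Measure.pi fun _ : Edge 3 L => haarProbability G)) /
              ((∫ V, ∏ p ∈ B, w (plaquetteHolonomy V p.1 p.2.1.1 p.2.1.2)
                ∂(Measure.pi fun _ : Edge 3 L => haarProbability G)) *
                ∏ p ∈ K \ B, w (plaquetteHolonomy U p.1 p.2.1.1 p.2.1.2)))⁻¹) U).toReal ≤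
            (M₂ / M) ^ s * (M ^ ((R - 1) ^ 3) / ∏ p ∈ K \ B, w (plaquetteHolonomy U p.1 p.2.1.1 p.2.1.2))) ∧
        ∀ θ : ℝ, 0 < θ → ∀ A : Set (GaugeConfig 3 L G), MeasurableSet A →
          (∀ U ∈ A, θ * M ^ ((R - 1) ^ 3) < ∏ p ∈ K \ B, w (plaquetteHolonomy U p.1 p.2.1.1 p.2.1.2)) →
          0 < π.real A →
          1 / (π.real A + (M₂ / M) ^ s / θ) - 1 / 2 ≤
            tauInt (fun n => autocov (indepMH q fun U =>
              ((∫ V, ∏ p ∈ K, w (plaquetteHolonomy V p.1 p.2.1.1 p.2.1.2)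
                  ∂(Measure.pi fun _ : Edge 3 L => haarProbability G)) /
                ((∫ V, ∏ p ∈ B, w (plaquetteHolonomy V p.1 p.2.1.1 p.2.1.2)
                  ∂(Measure.pi fun _ : Edge 3 L => haarProbability G)) *
                  ∏ p ∈ K \ B, w (plaquetteHolonomy U p.1 p.2.1.1 p.2.1.2)))⁻¹) π
                (fun U => A.indicator (fun _ => (1 : ℝ)) U - π.real A) n /
              autocov (indepMH q fun U =>
              ((∫ V, ∏ p ∈ K, w (plaquetteHolonomy V p.1 p.2.1.1 p.2.1.2)
                  ∂(Measure.pi fun _ : Edge 3 L => haarProbability G)) /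
                ((∫ V, ∏ p ∈ B, w (plaquetteHolonomy V p.1 p.2.1.1 p.2.1.2)
                  ∂(Measure.pi fun _ : Edge 3 L => haarProbability G)) *
                  ∏ p ∈ K \ B, w (plaquetteHolonomy U p.1 p.2.1.1 p.2.1.2)))⁻¹) π
                (fun U => A.indicator (fun _ => (1 : ℝ)) U - π.real A) 0) := by
  obtain ⟨B, t, rank, S, u, hBK, ht, hrank, hSK, hSB, huB, hut, humax, huinj, hk, hs⟩ :=
    exists_boxOptimal_closingSection_three (L := L) hR hRL K hK
  refine ⟨B, t, rank, S.card, hBK, ht, hrank, hk, hs, ?_⟩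
  intro π q _ _ hπ hq
  have h := closing_blockVolumeFloor (G := G) hL hw hm0 hm hM hM₂ hM₂' B t ht rank hrank K hBK S u hSK hSB huB
    hut humax huinj π q hπ hq
  rw [hk] at h
  exact h

end Summit.Ventures.LatticeQCDFlow.Theory2.Autoregressive

end
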